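import Literature.NumberTheory.Automorphic.LowestWeightBorel
import Literature.NumberTheory.Automorphic.SubQuotRep
import Literature.NumberTheory.Automorphic.RankOneOrbitBruhat
import HarnessLib

/-!
# Lowest weight data for a connected group: `G/B` in a representation with a spanning orbit
# and a lowest weight coordinate

Continuation of `LowestWeightBorel.lean` (Springer 6.4.8 (ii) by the lowest weight line). The
constructions used there — Chevalley's representation `ρ` with `B = Stab_G [v]` (5.5.3), the
closed orbit cone `C = k · ρ(G) v` (6.2.7 (ii)), a diagonal maximal torus `ρ(T)` with its
weights, a separating cocharacter `λ` and the lowest weight `χ₋` of the orbit — are packaged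
once and for all as a hypothesis structure `ChevalleyData G T B ρ v` (cf. `RankOneOrbitData` of
`RankOneOrbit.lean`, the semisimple-rank-one case) together with `ChevalleyData.IsLowest`, which
records the normalisation reached at the end of `LowestWeightBorel`:

* the orbit `ρ(G) v` **spans** `kᴺ` (restrict Chevalley's representation to the span of the
  orbit, `SubQuotRep.subRep`), so that every coordinate occurs in the orbit;
* `λ` separates the weights `χᵢ` of `ρ(T)`, the coordinate `i₁` has the lowest `λ`-weight and is
  the **only** coordinate of that weight (the lowest weight space is the line spanned by
  `π(ρ(G) v)`, `LowestWeightBorel`, step 2), and `v = e_{i₁}`.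

Main results: `exists_chevalleyData_isLowest` (existence, for every maximal torus `T` of a
Zariski-connected `G ≤ GL n k` over an algebraically closed field), and the API used by the proof
of Chevalley's theorem on the unipotent radical (Luna's argument, `Luna.lean`): the `T`-fixed
lines of `C` are the `[ρ(m) v]`, `m ∈ N_G(T)` (`smul_orb_of_fixed`), the lowest weight part of a
vector of `C` lies in `C` (`botPart_mem`), and the **covering lemma** `exists_coord_ne_zero`: for
every `w ∈ C ∖ 0` there is `m ∈ N_G(T)` with `(ρ(m)⁻¹ w)_{i₁} ≠ 0` (Milne, *Algebraic Groups*,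
17.65, proof: "*the (open affine) varieties `𝓑(B)`, `B ∈ 𝓑^T`, cover `𝓑`*").

## References

* T. A. Springer, *Linear Algebraic Groups*, 2nd ed., Birkhäuser (1998), 5.5.3, 6.2.7, 6.4.8,
  6.4.12, 7.1.5 [SpringerLAG1998].
* J. S. Milne, *Algebraic Groups*, CUP (2017), 17.65 [Milne2017].
-/

noncomputable section

open Matrix MvPolynomial
open scoped Pointwise

namespace Literature.NumberTheory.Automorphic

variable {k : Type*} [Field k] {n : Type*} [Fintype n] [DecidableEq n]

attribute [local instance] zariskiTopologyPi zariskiTopologyGL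

/-! ### The data -/

section Data

/-- **Chevalley data for `(G, T, B)`**: a rational representation `ρ : G → GL_N(k)` and a vector
`v ≠ 0` such that `B ⊇ T` is the stabiliser in `G` of the line `[v]` (Springer 5.5.3 applied to the
Borel subgroup `B`), `ρ(T)` is diagonal, the orbit cone `k · ρ(G) v` is closed (6.2.7 (ii)) and the
orbit `ρ(G) v` spans `kᴺ`. A hypothesis structure; such data exist for every maximal torus of a
Zariski-connected group (`exists_chevalleyData_isLowest`).
[cite: SpringerLAG1998, 5.5.3, 6.2.7 (ii)] -/
structure ChevalleyData (G T B : Subgroup (GL n k)) {N : ℕ} (ρ : ↥G →* GL (Fin N) k)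
    (v : Fin N → k) : Prop where
  /-- `G` is Zariski-connected. -/
  conn : IsZConnected G
  /-- `T` is a maximal torus of `G`. -/
  maxTorus : IsMaximalTorusIn T G
  /-- `B` is a Borel subgroup of `G`. -/
  borel : IsBorelIn B G
  /-- `T ≤ B`. -/
  torus_le : T ≤ B
  /-- `ρ` is an algebraic homomorphism. -/
  algebraic : MonoidHom.IsAlgebraicGL ρ
  /-- `ρ(T)` consists of diagonal matrices. -/
  diag : ∀ t : ↥T, ∃ d : Fin N → k,
    ((ρ ⟨t, maxTorus.1 t.2⟩ : GL (Fin N) k) : Matrix (Fin N) (Fin N) k) = Matrix.diagonal d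
  /-- `v ≠ 0`. -/
  ne_zero : v ≠ 0
  /-- The stabiliser of the line `k v` in `G` is exactly `B`. -/
  stab_iff : ∀ g : ↥G, (∃ c : k, ((ρ g : GL (Fin N) k) : Matrix (Fin N) (Fin N) k) *ᵥ v = c • v) ↔
    (g : GL n k) ∈ B
  /-- The orbit cone of `v` under `ρ(G)` is closed. -/
  closed : IsClosed (orbitCone ρ.range v)
  /-- The orbit `ρ(G) v` spans `kᴺ`. -/
  span : Submodule.span k (Set.range fun g : ↥G =>
    ((ρ g : GL (Fin N) k) : Matrix (Fin N) (Fin N) k) *ᵥ v) = ⊤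

/-- The orbit vector `ρ(g) v` of a representation `ρ : G → GL_N(k)`. [folklore] -/
def orbVec {G : Subgroup (GL n k)} {N : ℕ} (ρ : ↥G →* GL (Fin N) k) (v : Fin N → k) (g : ↥G) :
    Fin N → k :=
  ((ρ g : GL (Fin N) k) : Matrix (Fin N) (Fin N) k) *ᵥ v

/-- `orbVec ρ v g = ρ(g) v`. [folklore] -/
theorem orbVec_def {G : Subgroup (GL n k)} {N : ℕ} (ρ : ↥G →* GL (Fin N) k) (v : Fin N → k)
    (g : ↥G) : orbVec ρ v g = ((ρ g : GL (Fin N) k) : Matrix (Fin N) (Fin N) k) *ᵥ v := rfl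

/-- `ρ(g g') v = ρ(g) (ρ(g') v)`. [folklore] -/
theorem orbVec_mul {G : Subgroup (GL n k)} {N : ℕ} (ρ : ↥G →* GL (Fin N) k) (v : Fin N → k)
    (g g' : ↥G) :
    orbVec ρ v (g * g') = ((ρ g : GL (Fin N) k) : Matrix (Fin N) (Fin N) k) *ᵥ orbVec ρ v g' := by
  simp only [orbVec, map_mul, Units.val_mul, Matrix.mulVec_mulVec]

/-- `ρ(1) v = v`. [folklore] -/
theorem orbVec_one {G : Subgroup (GL n k)} {N : ℕ} (ρ : ↥G →* GL (Fin N) k) (v : Fin N → k) :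
    orbVec ρ v 1 = v := by simp [orbVec]

/-- Orbit vectors lie in the orbit cone. [folklore] -/
theorem orbVec_mem {G : Subgroup (GL n k)} {N : ℕ} (ρ : ↥G →* GL (Fin N) k) (v : Fin N → k)
    (g : ↥G) : orbVec ρ v g ∈ orbitCone ρ.range v :=
  ⟨1, ρ g, MonoidHom.mem_range.2 ⟨g, rfl⟩, by rw [one_smul]; rfl⟩

/-- `ρ(G)` preserves the orbit cone. [folklore] -/
theorem orbitCone_range_stable {G : Subgroup (GL n k)} {N : ℕ} (ρ : ↥G →* GL (Fin N) k)
    {v : Fin N → k} (g : ↥G) {w : Fin N → k} (hw : w ∈ orbitCone ρ.range v) :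
    ((ρ g : GL (Fin N) k) : Matrix (Fin N) (Fin N) k) *ᵥ w ∈ orbitCone ρ.range v :=
  mulVec_mem_orbitCone (MonoidHom.mem_range.2 ⟨g, rfl⟩) hw

/-- A non-zero vector of the orbit cone is `c • ρ(g) v` with `c ≠ 0`. [folklore] -/
theorem exists_eq_smul_orbVec {G : Subgroup (GL n k)} {N : ℕ} {ρ : ↥G →* GL (Fin N) k}
    {v : Fin N → k} {w : Fin N → k} (hw : w ∈ orbitCone ρ.range v) (hw0 : w ≠ 0) :
    ∃ (c : k) (g : ↥G), c ≠ 0 ∧ w = c • orbVec ρ v g := by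
  obtain ⟨c, _, ⟨g, rfl⟩, rfl⟩ := hw
  refine ⟨c, g, ?_, rfl⟩
  rintro rfl
  exact hw0 (by rw [zero_smul])

namespace ChevalleyData

variable {G T B : Subgroup (GL n k)} {N : ℕ} {ρ : ↥G →* GL (Fin N) k} {v : Fin N → k}
variable (h : ChevalleyData G T B ρ v)
include h

/-- `G` is algebraic. [folklore] -/
theorem alg : IsAlgebraicSubgroup G := h.conn.1

/-- `T` is a torus. [folklore] -/
theorem torus : IsTorusSubgroup T := h.maxTorus.2.1

/-- Orbit vectors are non-zero. [folklore] -/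
theorem orbVec_ne_zero (g : ↥G) : orbVec ρ v g ≠ 0 := by
  intro h0
  apply h.ne_zero
  have := congrArg (fun w => (((ρ g)⁻¹ : GL (Fin N) k) : Matrix (Fin N) (Fin N) k) *ᵥ w) h0
  simpa [orbVec, Matrix.mulVec_mulVec, ← Units.val_mul] using this

/-- **Every coordinate occurs in the orbit** (the orbit spans `kᴺ`). [folklore] -/
theorem exists_orbVec_apply_ne_zero (i : Fin N) : ∃ g : ↥G, orbVec ρ v g i ≠ 0 := by
  by_contra hall
  push Not at hall
  have hle : Submodule.span k (Set.range fun g : ↥G =>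
      ((ρ g : GL (Fin N) k) : Matrix (Fin N) (Fin N) k) *ᵥ v) ≤
      LinearMap.ker (LinearMap.proj i : (Fin N → k) →ₗ[k] k) := by
    rw [Submodule.span_le]
    rintro _ ⟨g, rfl⟩
    exact hall g
  rw [h.span, top_le_iff, LinearMap.ker_eq_top] at hle
  have := LinearMap.congr_fun hle (Pi.single i 1)
  simp at this

/-! #### The weights of `T` -/

/-- `ρ(t)` is the diagonal matrix of its diagonal entries. [folklore] -/
theorem rho_torus_eq_diagonal (t : ↥T) :
    ((ρ ⟨t, h.maxTorus.1 t.2⟩ : GL (Fin N) k) : Matrix (Fin N) (Fin N) k) =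
      Matrix.diagonal fun i =>
        ((ρ ⟨t, h.maxTorus.1 t.2⟩ : GL (Fin N) k) : Matrix (Fin N) (Fin N) k) i i := by
  obtain ⟨d, hd⟩ := h.diag t
  rw [hd]
  ext i j
  by_cases hij : i = j
  · subst hij; simp
  · simp [Matrix.diagonal_apply_ne _ hij]

/-- The diagonal entries of `ρ(t)` are non-zero. [folklore] -/
theorem rho_torus_apply_ne_zero (t : ↥T) (i : Fin N) :
    ((ρ ⟨t, h.maxTorus.1 t.2⟩ : GL (Fin N) k) : Matrix (Fin N) (Fin N) k) i i ≠ 0 := by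
  intro h0
  have hdet := (ρ ⟨t, h.maxTorus.1 t.2⟩).isUnit.map Matrix.detMonoidHom
  rw [Matrix.coe_detMonoidHom, h.rho_torus_eq_diagonal t, Matrix.det_diagonal] at hdet
  exact hdet.ne_zero (Finset.prod_eq_zero (Finset.mem_univ i) (by simpa using h0))

/-- **The weights `χᵢ : T → 𝔾ₘ` of `T` on `kᴺ`**: `ρ(t) = diag(χᵢ(t))` (Springer 7.1.1).
[cite: SpringerLAG1998, 7.1.1] -/
def wt (i : Fin N) : ↥T →* kˣ where
  toFun t := Units.mk0 _ (h.rho_torus_apply_ne_zero t i)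
  map_one' := Units.ext (by
    simp only [Units.val_mk0, Units.val_one]
    have : (⟨((1 : ↥T) : GL n k), h.maxTorus.1 (1 : ↥T).2⟩ : ↥G) = 1 := rfl
    rw [this, map_one, Units.val_one, Matrix.one_apply_eq])
  map_mul' s t := Units.ext (by
    simp only [Units.val_mk0, Units.val_mul]
    have : (⟨((s * t : ↥T) : GL n k), h.maxTorus.1 (s * t).2⟩ : ↥G) =
        ⟨(s : GL n k), h.maxTorus.1 s.2⟩ * ⟨(t : GL n k), h.maxTorus.1 t.2⟩ := rfl
    rw [this, map_mul, Units.val_mul, h.rho_torus_eq_diagonal s, h.rho_torus_eq_diagonal t,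
      Matrix.diagonal_mul_diagonal, Matrix.diagonal_apply_eq, Matrix.diagonal_apply_eq,
      Matrix.diagonal_apply_eq])

/-- `χᵢ(t) = ρ(t)ᵢᵢ`. [folklore] -/
@[simp] theorem coe_wt (i : Fin N) (t : ↥T) :
    ((h.wt i t : kˣ) : k) =
      ((ρ ⟨t, h.maxTorus.1 t.2⟩ : GL (Fin N) k) : Matrix (Fin N) (Fin N) k) i i := rfl

/-- `ρ(t) w = (χᵢ(t) wᵢ)ᵢ`. [folklore] -/
theorem rho_torus_mulVec (t : ↥T) (w : Fin N → k) :
    ((ρ ⟨t, h.maxTorus.1 t.2⟩ : GL (Fin N) k) : Matrix (Fin N) (Fin N) k) *ᵥ w =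
      fun i => ((h.wt i t : kˣ) : k) * w i := by
  rw [h.rho_torus_eq_diagonal t]
  funext i
  rw [Matrix.mulVec_diagonal]
  rfl

/-- The weights are algebraic characters. [folklore] -/
theorem isAlgebraicChar_wt (i : Fin N) : IsAlgebraicChar (h.wt i) := by
  obtain ⟨P, hP⟩ := h.algebraic
  refine ⟨P (Sum.inl (i, i)), fun t => ?_⟩
  rw [coe_wt, ← glCoordFun_inl, hP]

/-- The weight `χᵢ` as an element of `X*(T)`. [folklore] -/
def wtL (i : Fin N) : ↥(characterLattice T) := ⟨h.wt i, h.isAlgebraicChar_wt i⟩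

/-- `wtL` coerces to `wt`. [folklore] -/
@[simp] theorem coe_wtL (i : Fin N) : (h.wtL i : ↥T →* kˣ) = h.wt i := rfl

/-- The integer weights `mᵢ = ⟨χᵢ, λ⟩` of a cocharacter `λ`. [folklore] -/
def wtInt [IsMulCommutative ↥T] (γ : ↥(cocharacterLattice T)) (i : Fin N) : ℤ :=
  charPairingInt (h.wt i) (γ : kˣ →* ↥T)

/-- **`ρ(λ(c)) = diag(c^{mᵢ})`** (Springer 3.2.11 (i)). [cite: SpringerLAG1998, 3.2.11 (i)] -/
theorem rho_cochar [IsAlgClosed k] [IsMulCommutative ↥T] (γ : ↥(cocharacterLattice T)) (c : kˣ) :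
    ((ρ ⟨((γ : kˣ →* ↥T) c : GL n k), h.maxTorus.1 ((γ : kˣ →* ↥T) c).2⟩ : GL (Fin N) k) :
        Matrix (Fin N) (Fin N) k) =
      ((weightDiagGL (h.wtInt γ) c : GL (Fin N) k) : Matrix (Fin N) (Fin N) k) := by
  rw [h.rho_torus_eq_diagonal ((γ : kˣ →* ↥T) c), weightDiagGL, coe_diagonalGL]
  congr 1
  funext i
  have h1 := charPairingInt_spec_holds (T := T) (h.isAlgebraicChar_wt i) γ.2 c
  rw [← h.coe_wt, h1]
  rfl

end ChevalleyData

/-- **Lowest weight normalisation** of Chevalley data with respect to a cocharacter `λ` and a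
coordinate `i₁`: `λ` separates the weights of `ρ(T)`, the coordinate `i₁` has the lowest
`λ`-weight and is the only coordinate of that weight, and `v = e_{i₁}`. (So `[v]` is the
attracting fixed point `x₋` of Milne 17.65 / Springer 7.1.5, and the lowest weight space is a
line.) [cite: Milne2017, 17.65 (proof)] -/
structure ChevalleyData.IsLowest {G T B : Subgroup (GL n k)} {N : ℕ} {ρ : ↥G →* GL (Fin N) k}
    {v : Fin N → k} [IsMulCommutative ↥T] (h : ChevalleyData G T B ρ v)
    (γ : ↥(cocharacterLattice T)) (i₁ : Fin N) : Prop where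
  /-- `λ` separates the weights. -/
  sep : ∀ i j, h.wtInt γ i = h.wtInt γ j → h.wt i = h.wt j
  /-- `i₁` has the lowest weight. -/
  low : ∀ i, h.wtInt γ i₁ ≤ h.wtInt γ i
  /-- `i₁` is the only coordinate of lowest weight. -/
  uniq : ∀ i, h.wtInt γ i = h.wtInt γ i₁ → i = i₁
  /-- `v = e_{i₁}`. -/
  v_eq : v = Pi.single i₁ 1

namespace ChevalleyData

variable {G T B : Subgroup (GL n k)} {N : ℕ} {ρ : ↥G →* GL (Fin N) k} {v : Fin N → k}
variable (h : ChevalleyData G T B ρ v)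
include h

/-! #### `T`-fixed lines of the orbit and the covering lemma -/

/-- **The `T`-fixed lines of `G/B` come from `N_G(T)`**: if `ρ(T)` fixes the line of `ρ(g) v`
then `ρ(g) v = c • ρ(x) v` for some `x ∈ N_G(T)` (`g ∈ N_G(T) · B`,
`exists_mem_normalizer_mul_of_map_conj_le`). [cite: SpringerLAG1998, 6.4.12] -/
theorem exists_normalizer_of_fixed [IsAlgClosed k] {g : ↥G}
    (hfix : ∀ t : ↥T, ∃ c : k,
      ((ρ ⟨t, h.maxTorus.1 t.2⟩ : GL (Fin N) k) : Matrix (Fin N) (Fin N) k) *ᵥ orbVec ρ v g =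
        c • orbVec ρ v g) :
    ∃ (x : GL n k) (hx : x ∈ G), x ∈ Subgroup.normalizer (T : Set (GL n k)) ∧
      ∃ c : k, c ≠ 0 ∧ orbVec ρ v g = c • orbVec ρ v ⟨x, hx⟩ := by
  have hle : T.map (MulAut.conj (g : GL n k)⁻¹ : GL n k →* GL n k) ≤ B := by
    rintro _ ⟨t, ht, rfl⟩
    obtain ⟨c, hc⟩ := hfix ⟨t, ht⟩
    have hc' : ((ρ ⟨t, h.maxTorus.1 ht⟩ : GL (Fin N) k) : Matrix (Fin N) (Fin N) k) *ᵥ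
        orbVec ρ v g = c • orbVec ρ v g := hc
    have hmem : (g : GL n k)⁻¹ * t * g ∈ G :=
      G.mul_mem (G.mul_mem (G.inv_mem g.2) (h.maxTorus.1 ht)) g.2
    have e : ((MulAut.conj (g : GL n k)⁻¹ : GL n k →* GL n k) t) = (g : GL n k)⁻¹ * t * g := by
      simp
    rw [e]
    refine (h.stab_iff ⟨_, hmem⟩).1 ⟨c, ?_⟩
    have e2 : (⟨(g : GL n k)⁻¹ * t * g, hmem⟩ : ↥G) = g⁻¹ * ⟨t, h.maxTorus.1 ht⟩ * g :=
      Subtype.ext rfl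
    rw [e2, ← orbVec_def, orbVec_mul, map_mul, Units.val_mul, ← Matrix.mulVec_mulVec, hc',
      Matrix.mulVec_smul, ← orbVec_mul, inv_mul_cancel, orbVec_one]
  obtain ⟨x, hxG, hxN, b, hb, hgxb⟩ :=
    exists_mem_normalizer_mul_of_map_conj_le h.maxTorus h.borel h.torus_le g.2 hle
  obtain ⟨cb, hcb⟩ := (h.stab_iff ⟨b, h.borel.1 hb⟩).2 hb
  have hg : g = ⟨x, hxG⟩ * ⟨b, h.borel.1 hb⟩ := Subtype.ext hgxb
  have hcb0 : cb ≠ 0 := by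
    rintro rfl
    rw [zero_smul] at hcb
    exact h.orbVec_ne_zero ⟨b, h.borel.1 hb⟩ hcb
  refine ⟨x, hxG, hxN, cb, hcb0, ?_⟩
  rw [hg, orbVec_mul, orbVec_def ρ v ⟨b, h.borel.1 hb⟩, hcb, Matrix.mulVec_smul, ← orbVec_def]

/-- **The lowest weight part of a vector of the orbit cone lies in the orbit cone**
(`ConeWeights.botPart_mem_of_isClosed` with `ρ(λ(c)) = diag(c^{mᵢ})`; Springer 7.1.5, proof).
[cite: SpringerLAG1998, 7.1.5 (proof)] -/
theorem botPart_mem [IsAlgClosed k] [IsMulCommutative ↥T] (γ : ↥(cocharacterLattice T))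
    {w : Fin N → k} (hw : w ∈ orbitCone ρ.range v) :
    botPart (h.wtInt γ) w ∈ orbitCone ρ.range v :=
  botPart_mem_of_isClosed _ _ isConeSet_orbitCone h.closed fun c => by
    rw [← h.rho_cochar γ c]
    exact orbitCone_range_stable ρ _ hw

/-- If `λ` separates the weights, `ρ(T)` acts on the lowest weight part of `w` through the
character of any index of its support. [folklore] -/
theorem rho_torus_mulVec_botPart [IsMulCommutative ↥T] {γ : ↥(cocharacterLattice T)}
    (hsep : ∀ i j, h.wtInt γ i = h.wtInt γ j → h.wt i = h.wt j) {w : Fin N → k} {i₀ : Fin N}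
    (hi₀ : botPart (h.wtInt γ) w i₀ ≠ 0) (t : ↥T) :
    ((ρ ⟨t, h.maxTorus.1 t.2⟩ : GL (Fin N) k) : Matrix (Fin N) (Fin N) k) *ᵥ botPart (h.wtInt γ) w =
      ((h.wt i₀ t : kˣ) : k) • botPart (h.wtInt γ) w := by
  rw [h.rho_torus_mulVec]
  funext i
  simp only [Pi.smul_apply, smul_eq_mul]
  by_cases hi : botPart (h.wtInt γ) w i = 0
  · rw [hi, mul_zero, mul_zero]
  · rw [hsep i i₀ ((botPart_apply_ne_zero _ _ hi).2.trans (botPart_apply_ne_zero _ _ hi₀).2.symm)]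

/-- For `x ∈ N_G(T)`: `ρ(x)⁻¹ ρ(t) y = ρ(x⁻¹ t x) ρ(x)⁻¹ y` is `ρ(x)⁻¹ y` rescaled coordinatewise by
the weights at `x⁻¹ t x ∈ T`. [folklore] -/
theorem rho_inv_torus_mulVec_apply {x : GL n k} (hxG : x ∈ G)
    (hxN : x ∈ Subgroup.normalizer (T : Set (GL n k))) (t : ↥T) (y : Fin N → k) (i : Fin N) :
    ∃ ht' : x⁻¹ * t * x ∈ T,
    ((((ρ ⟨x, hxG⟩)⁻¹ : GL (Fin N) k) : Matrix (Fin N) (Fin N) k) *ᵥ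
      (((ρ ⟨t, h.maxTorus.1 t.2⟩ : GL (Fin N) k) : Matrix (Fin N) (Fin N) k) *ᵥ y)) i =
      ((h.wt i ⟨x⁻¹ * t * x, ht'⟩ : kˣ) : k) *
        ((((ρ ⟨x, hxG⟩)⁻¹ : GL (Fin N) k) : Matrix (Fin N) (Fin N) k) *ᵥ y) i := by
  have ht' : x⁻¹ * t * x ∈ T := by
    have h1 := (Subgroup.mem_normalizer_iff.1 ((Subgroup.normalizer (T : Set (GL n k))).inv_mem hxN)
      t).1 t.2
    simpa using h1
  refine ⟨ht', ?_⟩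
  have e : (((ρ ⟨x, hxG⟩)⁻¹ : GL (Fin N) k) : Matrix (Fin N) (Fin N) k) *
      ((ρ ⟨t, h.maxTorus.1 t.2⟩ : GL (Fin N) k) : Matrix (Fin N) (Fin N) k) =
      ((ρ ⟨x⁻¹ * t * x, h.maxTorus.1 ht'⟩ : GL (Fin N) k) : Matrix (Fin N) (Fin N) k) *
        (((ρ ⟨x, hxG⟩)⁻¹ : GL (Fin N) k) : Matrix (Fin N) (Fin N) k) := by
    rw [← Units.val_mul, ← Units.val_mul, ← map_inv, ← map_mul, ← map_mul]
    congr 2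
    apply Subtype.ext
    simp [mul_assoc]
  rw [Matrix.mulVec_mulVec, e, ← Matrix.mulVec_mulVec,
    h.rho_torus_mulVec ⟨x⁻¹ * t * x, ht'⟩]

/-- **Covering lemma** (Milne 17.65, proof: "*the varieties `𝓑(B)`, `B ∈ 𝓑^T`, cover `𝓑`*"):
in lowest weight normalisation, for every non-zero `w` of the orbit cone there is `x ∈ N_G(T)`
with `(ρ(x)⁻¹ w)_{i₁} ≠ 0`, i.e. `[w]` lies in the translate by `x` of the open cell
`{[y] | y_{i₁} ≠ 0}`. Proof: the lowest weight part `z` of `w` lies in the orbit cone and spans a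
`T`-fixed line, so `z = c ρ(x) v`, `x ∈ N_G(T)`; if `(ρ(x)⁻¹ w)_{i₁} = 0` then the closed
`T`-stable cone `{(ρ(x)⁻¹ y)_{i₁} = 0}` contains `w`, hence `z`, but `ρ(x)⁻¹ z = c v = c e_{i₁}`.
[cite: Milne2017, 17.65 (proof)] -/
theorem exists_coord_ne_zero [IsAlgClosed k] [IsMulCommutative ↥T] {γ : ↥(cocharacterLattice T)}
    {i₁ : Fin N} (hl : h.IsLowest γ i₁) {w : Fin N → k} (hw : w ∈ orbitCone ρ.range v)
    (hw0 : w ≠ 0) :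
    ∃ (x : GL n k) (hx : x ∈ G), x ∈ Subgroup.normalizer (T : Set (GL n k)) ∧
      ((((ρ ⟨x, hx⟩)⁻¹ : GL (Fin N) k) : Matrix (Fin N) (Fin N) k) *ᵥ w) i₁ ≠ 0 := by
  set z : Fin N → k := botPart (h.wtInt γ) w with hzdef
  have hz : z ∈ orbitCone ρ.range v := h.botPart_mem γ hw
  have hz0 : z ≠ 0 := botPart_ne_zero _ _ hw0
  obtain ⟨c, g, hc, hzg⟩ := exists_eq_smul_orbVec hz hz0
  obtain ⟨i₀, hi₀⟩ := Function.ne_iff.1 hz0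
  -- `T` fixes the line of `ρ(g) v`
  have hfix : ∀ t : ↥T, ∃ c' : k,
      ((ρ ⟨t, h.maxTorus.1 t.2⟩ : GL (Fin N) k) : Matrix (Fin N) (Fin N) k) *ᵥ orbVec ρ v g =
        c' • orbVec ρ v g := by
    intro t
    refine ⟨((h.wt i₀ t : kˣ) : k), ?_⟩
    have h1 := h.rho_torus_mulVec_botPart hl.sep hi₀ t
    rw [← hzdef, hzg, Matrix.mulVec_smul, smul_comm] at h1
    exact smul_right_injective _ hc h1
  obtain ⟨x, hxG, hxN, c', hc', hgx⟩ := h.exists_normalizer_of_fixed hfix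
  refine ⟨x, hxG, hxN, fun h0 => ?_⟩
  -- the closed `T`-stable cone `D = {(ρ(x)⁻¹ y)_{i₁} = 0}` contains `w`, hence `z`
  set D : Set (Fin N → k) :=
    {y | ((((ρ ⟨x, hxG⟩)⁻¹ : GL (Fin N) k) : Matrix (Fin N) (Fin N) k) *ᵥ y) i₁ = 0} with hDdef
  have hzD : z ∈ D := by
    refine botPart_mem_of_isClosed _ _ ?_ ?_ ?_
    · intro a _ y hy
      simp only [hDdef, Set.mem_setOf_eq, Matrix.mulVec_smul, Pi.smul_apply, smul_eq_mul] at hy ⊢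
      rw [hy, mul_zero]
    · have : D = {y : Fin N → k | MvPolynomial.eval y
          (∑ j, MvPolynomial.C ((((ρ ⟨x, hxG⟩)⁻¹ : GL (Fin N) k) : Matrix (Fin N) (Fin N) k) i₁ j) *
            MvPolynomial.X j) = 0} := by
        ext y
        simp [hDdef, Matrix.mulVec, dotProduct]
      rw [this]
      exact isClosed_setOf_eval_eq_zero _
    · intro a
      simp only [hDdef, Set.mem_setOf_eq]
      obtain ⟨_, e⟩ := h.rho_inv_torus_mulVec_apply hxG hxN ((γ : kˣ →* ↥T) a) w i₁
      rw [← h.rho_cochar γ a, e, h0, mul_zero]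
  -- but `ρ(x)⁻¹ z = c c' v = c c' e_{i₁}`
  simp only [hDdef, Set.mem_setOf_eq] at hzD
  rw [hzg, hgx, Matrix.mulVec_smul, Matrix.mulVec_smul, orbVec_def, Matrix.mulVec_mulVec,
    ← Units.val_mul, inv_mul_cancel, Units.val_one, Matrix.one_mulVec, hl.v_eq] at hzD
  simp only [Pi.smul_apply, Pi.single_eq_same, smul_eq_mul, mul_one, mul_eq_zero] at hzD
  rcases hzD with h1 | h1
  · exact hc h1
  · exact hc' h1

end ChevalleyData

end Data

/-! ### The lowest weight line -/

section Line

namespace ChevalleyData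

variable {G T B : Subgroup (GL n k)} {N : ℕ} {ρ : ↥G →* GL (Fin N) k} {v : Fin N → k}
variable (h : ChevalleyData G T B ρ v)
include h

/-- **The lowest weight line** (the heart of `LowestWeightBorel`, restated for Chevalley data):
if `λ` separates the weights and `μ` is the lowest `λ`-weight, the projections
`π(ρ(g) v)` of the orbit onto the `μ`-weight coordinates all lie on one line `k · ρ(r₀) v` with
`r₀ ∈ N_G(T)`. Proof: `π(ρ(g) v)` is the lowest weight part of `ρ(g) v`, a vector of the closed
orbit cone spanning a `T`-fixed line, and these are the finitely many `[ρ(r) v]`, `r` running over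
representatives of `N_G(T) / N_G(T)°`; the image of the irreducible `G` under the continuous
`g ↦ π(ρ(g) v)` lies in one of them. [cite: SpringerLAG1998, 6.4.8 (ii) (proof above), 7.1.5] -/
theorem exists_lowest_line [IsAlgClosed k] [IsMulCommutative ↥T] (γ : ↥(cocharacterLattice T))
    (hsep : ∀ i j, h.wtInt γ i = h.wtInt γ j → h.wt i = h.wt j) {μ : ℤ}
    (hμ : ∀ i, μ ≤ h.wtInt γ i) (hμex : ∃ i, h.wtInt γ i = μ) :
    ∃ (r₀ : GL n k) (hr₀ : r₀ ∈ G), r₀ ∈ Subgroup.normalizer (T : Set (GL n k)) ∧ ∀ g : ↥G,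
      (fun i => if h.wtInt γ i = μ then orbVec ρ v g i else 0) ∈
        (k ∙ orbVec ρ v ⟨r₀, hr₀⟩ : Submodule k (Fin N → k)) := by
  classical
  obtain ⟨i₁, hi₁⟩ := hμex
  set m : Fin N → ℤ := h.wtInt γ with hmdef
  let π : (Fin N → k) → (Fin N → k) := fun w i => if m i = μ then w i else 0
  -- the eigenvector condition for the lowest weight `χ₋ = wt i₁`
  let Eig : (Fin N → k) → Prop := fun z => ∀ t : ↥T,
    ((ρ ⟨t, h.maxTorus.1 t.2⟩ : GL (Fin N) k) : Matrix (Fin N) (Fin N) k) *ᵥ z =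
      ((h.wt i₁ t : kˣ) : k) • z
  have hEig_smul : ∀ (c : k) {z : Fin N → k}, Eig z → Eig (c • z) := by
    intro c z hz t
    rw [Matrix.mulVec_smul, hz t, smul_comm]
  have hπ_eig : ∀ w : Fin N → k, Eig (π w) := by
    intro w t
    rw [h.rho_torus_mulVec]
    funext i
    simp only [Pi.smul_apply, smul_eq_mul, π]
    by_cases hi : m i = μ
    · rw [if_pos hi]
      by_cases hwi : w i = 0
      · rw [hwi, mul_zero, mul_zero]
      · rw [hsep i i₁ (hi.trans hi₁.symm)]
    · rw [if_neg hi, mul_zero, mul_zero]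
  -- `π (ρ(g) v)` is the lowest weight part of `ρ(g) v`, hence lies in the orbit cone
  have hπC : ∀ g : ↥G, π (orbVec ρ v g) ∈ orbitCone ρ.range v := by
    intro g
    by_cases h0 : π (orbVec ρ v g) = 0
    · rw [h0]; exact zero_mem_orbitCone
    obtain ⟨i, hi⟩ := Function.ne_iff.1 h0
    have hi' : m i = μ ∧ orbVec ρ v g i ≠ 0 := by
      by_cases hmi : m i = μ
      · exact ⟨hmi, by simpa [π, hmi] using hi⟩
      · exact absurd (by simp [π, hmi]) hi
    have hmin : minWeight m (orbVec ρ v g) = μ :=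
      le_antisymm (hi'.1 ▸ minWeight_le m (orbVec ρ v g) hi'.2)
        (le_minWeight (h.orbVec_ne_zero g) fun j _ => hμ j)
    have hbot : botPart m (orbVec ρ v g) = π (orbVec ρ v g) := by
      funext j
      simp only [botPart, hmin, π]
    rw [← hbot]
    exact h.botPart_mem γ (orbVec_mem ρ v g)
  -- representatives of `N_G(T) / N_G(T)°`
  set M : Subgroup (GL n k) := G ⊓ Subgroup.normalizer (T : Set (GL n k)) with hMdef
  have hMalg : IsAlgebraicSubgroup M := h.conn.1.inf h.torus.1.1.normalizer
  have hM₀B : identityComponent M ≤ B :=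
    identityComponent_normalizer_le_of_isBorelIn h.conn h.maxTorus h.borel h.torus_le
  haveI hfi : ((identityComponent M).subgroupOf M).FiniteIndex :=
    finiteIndex_identityComponent hMalg
  set R : Set (GL n k) := Set.range fun q : ↥M ⧸ (identityComponent M).subgroupOf M =>
    ((q.out : ↥M) : GL n k) with hRdef
  have hRfin : R.Finite := Set.finite_range _
  have hRM : R ⊆ M := by rintro _ ⟨q, rfl⟩; exact (q.out).2
  have hR : ∀ x ∈ M, ∃ r ∈ R, ∃ y ∈ identityComponent M, x = r * y := by
    intro x hx
    obtain ⟨y, hy⟩ :=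
      QuotientGroup.mk_out_eq_mul ((identityComponent M).subgroupOf M) (⟨x, hx⟩ : ↥M)
    refine ⟨_, ⟨QuotientGroup.mk (⟨x, hx⟩ : ↥M), rfl⟩, ((y : ↥M) : GL n k)⁻¹,
      (identityComponent M).inv_mem ((Subgroup.mem_subgroupOf).1 y.2), ?_⟩
    have hy' := congrArg (fun z : ↥M => (z : GL n k)) hy
    simp only [Subgroup.coe_mul] at hy'
    dsimp only
    rw [hy', mul_inv_cancel_right]
  have hRne : R.Nonempty := ⟨_, ⟨QuotientGroup.mk (1 : ↥M), rfl⟩⟩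
  -- the lines `L r = k · ρ(r) v`
  let L : GL n k → Set (Fin N → k) := fun r =>
    if hr : r ∈ G then ((k ∙ orbVec ρ v ⟨r, hr⟩ : Submodule k (Fin N → k)) : Set (Fin N → k))
    else {0}
  have hLG : ∀ (r : GL n k) (hr : r ∈ G),
      L r = ((k ∙ orbVec ρ v ⟨r, hr⟩ : Submodule k (Fin N → k)) : Set (Fin N → k)) :=
    fun r hr => dif_pos hr
  have hLcl : ∀ r, IsClosed (L r) := by
    intro r
    by_cases hr : r ∈ G
    · simp only [L, dif_pos hr]; exact isClosed_coe_submodule _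
    · simp only [L, dif_neg hr]
      haveI : T1Space (Fin N → k) := ⟨isClosed_singleton_pi⟩
      exact isClosed_singleton
  -- Claim A: every `π (ρ(g) v)` lies on one of the lines `L r`, `r ∈ R`
  have hA : ∀ g : ↥G, ∃ r ∈ R, π (orbVec ρ v g) ∈ L r := by
    intro g
    by_cases h0 : π (orbVec ρ v g) = 0
    · obtain ⟨r, hr⟩ := hRne
      refine ⟨r, hr, ?_⟩
      rw [hLG r (hRM hr).1, h0]
      exact Submodule.zero_mem _
    obtain ⟨c, g₂, hc, hcg⟩ := exists_eq_smul_orbVec (hπC g) h0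
    have hfix : ∀ t : ↥T, ∃ c' : k,
        ((ρ ⟨t, h.maxTorus.1 t.2⟩ : GL (Fin N) k) : Matrix (Fin N) (Fin N) k) *ᵥ orbVec ρ v g₂ =
          c' • orbVec ρ v g₂ := by
      intro t
      refine ⟨((h.wt i₁ t : kˣ) : k), ?_⟩
      have h1 := hπ_eig (orbVec ρ v g) t
      rw [hcg, Matrix.mulVec_smul, smul_comm] at h1
      exact smul_right_injective _ hc h1
    obtain ⟨x, hxG, hxN, c', hc', hgx⟩ := h.exists_normalizer_of_fixed hfix
    obtain ⟨r, hr, y, hy, rfl⟩ := hR x ⟨hxG, hxN⟩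
    obtain ⟨cy, hcy⟩ := (h.stab_iff ⟨y, (identityComponent_le M hy).1⟩).2 (hM₀B hy)
    have hrG : r ∈ G := (hRM hr).1
    refine ⟨r, hr, ?_⟩
    rw [hLG r hrG]
    refine Submodule.mem_span_singleton.2 ⟨c * (c' * cy), ?_⟩
    rw [hcg, hgx, show (⟨r * y, hxG⟩ : ↥G) = ⟨r, hrG⟩ * ⟨y, (identityComponent_le M hy).1⟩ from rfl,
      orbVec_mul, orbVec_def ρ v ⟨y, _⟩, hcy, Matrix.mulVec_smul, ← orbVec_def, smul_smul,
      smul_smul, mul_assoc]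
  -- continuity of `g ↦ π (ρ(g) v)` on `G`
  obtain ⟨P, hP⟩ := h.algebraic
  have hφcont : Continuous fun g : ↥G => π (orbVec ρ v g) := by
    have hΦ : Continuous fun x : GL n k => fun i =>
        if m i = μ then ∑ j, MvPolynomial.eval (glCoordFun x) (P (Sum.inl (i, j))) * v j
        else 0 := by
      refine continuous_of_polynomial_GL_pi
        (fun i => if m i = μ then ∑ j, P (Sum.inl (i, j)) * MvPolynomial.C (v j) else 0)
        fun x i => ?_
      by_cases hi : m i = μ
      · simp [hi, map_sum]
      · simp [hi]
    have heq : (fun g : ↥G => π (orbVec ρ v g)) = (fun x : GL n k => fun i =>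
        if m i = μ then ∑ j, MvPolynomial.eval (glCoordFun x) (P (Sum.inl (i, j))) * v j else 0) ∘
        Subtype.val := by
      funext g i
      simp only [π, Function.comp_apply, orbVec, Matrix.mulVec, dotProduct, ← hP, glCoordFun_inl]
    rw [heq]
    exact hΦ.comp continuous_subtype_val
  -- irreducibility puts the image on one line
  haveI : IrreducibleSpace ↥G := Subtype.irreducibleSpace h.conn.isIrreducible
  have hirr : IsIrreducible ((fun g : ↥G => π (orbVec ρ v g)) '' Set.univ) :=
    (IrreducibleSpace.isIrreducible_univ ↥G).image _ hφcont.continuousOn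
  obtain ⟨Z, hZ, hsub⟩ := isIrreducible_iff_sUnion_isClosed.1 hirr (hRfin.toFinset.image L)
    (by
      intro Z hZ
      obtain ⟨r, -, rfl⟩ := Finset.mem_image.1 hZ
      exact hLcl r)
    (by
      rintro _ ⟨g, -, rfl⟩
      obtain ⟨r, hr, hmem⟩ := hA g
      exact Set.mem_sUnion.2 ⟨L r, Finset.mem_coe.2 (Finset.mem_image.2
        ⟨r, hRfin.mem_toFinset.2 hr, rfl⟩), hmem⟩)
  obtain ⟨r₀, hr₀, rfl⟩ := Finset.mem_image.1 hZ
  have hr₀M : r₀ ∈ M := hRM (hRfin.mem_toFinset.1 hr₀)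
  refine ⟨r₀, hr₀M.1, hr₀M.2, fun g => ?_⟩
  have h1 := hsub ⟨g, Set.mem_univ g, rfl⟩
  rw [hLG r₀ hr₀M.1] at h1
  exact h1

end ChevalleyData

end Line

/-! ### Existence of lowest weight data -/

section Existence

variable [IsAlgClosed k]

omit [IsAlgClosed k] in
/-- Composing an algebraic homomorphism into `H ≤ GL_{N₀}` with an algebraic homomorphism of `H`
gives an algebraic homomorphism (substitute the coordinate polynomials). [folklore] -/
theorem MonoidHom.IsAlgebraicGL.comp_codRestrict {G : Subgroup (GL n k)} {N₀ d : ℕ}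
    {H : Subgroup (GL (Fin N₀) k)} {ρ : ↥G →* GL (Fin N₀) k} (hρ : MonoidHom.IsAlgebraicGL ρ)
    (hρH : ∀ g, ρ g ∈ H) {σ : ↥H →* GL (Fin d) k} (hσ : MonoidHom.IsAlgebraicGL σ) :
    MonoidHom.IsAlgebraicGL (σ.comp (ρ.codRestrict H hρH)) := by
  obtain ⟨P, hP⟩ := hρ
  obtain ⟨Q, hQ⟩ := hσ
  refine ⟨fun c => MvPolynomial.bind₁ P (Q c), fun g c => ?_⟩
  rw [MonoidHom.comp_apply, hQ, eval_bind₁']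
  have h1 : glCoordFun ((ρ.codRestrict H hρH g : ↥H) : GL (Fin N₀) k) =
      fun i => MvPolynomial.eval (glCoordFun (g : GL n k)) (P i) := funext fun i => hP g i
  rw [h1]

omit [IsAlgClosed k] in
/-- Rescaling the base vector within its orbit does not change the orbit cone. [folklore] -/
theorem orbitCone_eq_of_eq_smul_orbVec {G : Subgroup (GL n k)} {N : ℕ} (ρ : ↥G →* GL (Fin N) k)
    {v v' : Fin N → k} {a : k} (ha : a ≠ 0) (g₀ : ↥G) (hv' : v' = a • orbVec ρ v g₀) :
    orbitCone ρ.range v' = orbitCone ρ.range v := by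
  ext w
  constructor
  · rintro ⟨c, _, ⟨g, rfl⟩, rfl⟩
    refine ⟨c * a, ρ (g * g₀), MonoidHom.mem_range.2 ⟨g * g₀, rfl⟩, ?_⟩
    rw [hv', Matrix.mulVec_smul, ← orbVec_mul, smul_smul]
    rfl
  · rintro ⟨c, _, ⟨g, rfl⟩, rfl⟩
    refine ⟨c * a⁻¹, ρ (g * g₀⁻¹), MonoidHom.mem_range.2 ⟨g * g₀⁻¹, rfl⟩, ?_⟩
    rw [hv', Matrix.mulVec_smul, ← orbVec_mul, inv_mul_cancel_right, smul_smul, mul_assoc,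
      inv_mul_cancel₀ ha, mul_one]
    rfl

/-- **Existence of lowest weight data**: for a maximal torus `T` of a Zariski-connected
`G ≤ GL n k` over an algebraically closed field there are a Borel subgroup `B ⊇ T`, Chevalley
data `(ρ, v)` for `(G, T, B)` with spanning orbit, a separating cocharacter `λ` and a coordinate
`i₁` in lowest weight normalisation. Construction: Chevalley's representation for a Borel
subgroup `B₀ ⊇ T` (5.5.3), restricted to the span of the orbit (`SubQuotRep.subRep`) and
conjugated to diagonalise `ρ(T)` (`exists_conj_le_diagonalSubgroup`); a separating `λ`
(`exists_cochar_separating`); the lowest weight line `k · ρ(r₀) v` (`exists_lowest_line`) is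
the whole lowest weight space because the orbit spans; finally replace `(B₀, v)` by
`(r₀ B₀ r₀⁻¹, e_{i₁})`. [cite: SpringerLAG1998, 5.5.3, 6.2.7 (ii), 7.1.5] -/
theorem exists_chevalleyData_isLowest {G T : Subgroup (GL n k)} (hG : IsZConnected G)
    (hT : IsMaximalTorusIn T G) [IsMulCommutative ↥T] :
    ∃ (B : Subgroup (GL n k)) (N : ℕ) (ρ : ↥G →* GL (Fin N) k) (v : Fin N → k)
      (γ : ↥(cocharacterLattice T)) (i₁ : Fin N) (h : ChevalleyData G T B ρ v),
      h.IsLowest γ i₁ := by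
  classical
  have hTt : IsTorusSubgroup T := hT.2.1
  haveI : IsSolvable ↥T := isSolvable_of_comm fun a b => hTt.2.1.is_comm.comm a b
  -- Step 0: a Borel subgroup `B₀ ⊇ T` and Chevalley's representation
  obtain ⟨B₀, hB₀, hTB₀⟩ := exists_isBorelIn_ge hT.1 hTt.1 inferInstance
  obtain ⟨N₀, ρ₀, P₀, v₀, hP₀, hv₀, hstab₀⟩ := exists_rep_lineStabilizer_eq B₀ hB₀.2.1.1
  set ρ₀G : ↥G →* GL (Fin N₀) k := ρ₀.comp G.subtype with hρ₀Gdef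
  have hρ₀G : MonoidHom.IsAlgebraicGL ρ₀G := ⟨P₀, fun g c => hP₀ g c⟩
  -- Step 1: restrict to the span `W` of the orbit
  set W : Submodule k (Fin N₀ → k) := Submodule.span k (Set.range fun g : ↥G =>
    ((ρ₀G g : GL (Fin N₀) k) : Matrix (Fin N₀) (Fin N₀) k) *ᵥ v₀) with hWdef
  have hmemW : ∀ g : ↥G, ((ρ₀G g : GL (Fin N₀) k) : Matrix (Fin N₀) (Fin N₀) k) *ᵥ v₀ ∈ W :=
    fun g => Submodule.subset_span ⟨g, rfl⟩
  have hv₀W : v₀ ∈ W := by simpa [hρ₀Gdef] using hmemW 1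
  have hstabW : ∀ g : ↥G, ρ₀G g ∈ stabSubmodule W := by
    intro g
    rw [mem_stabSubmodule_iff]
    have hle : W.map (Matrix.mulVecLin ((ρ₀G g : GL (Fin N₀) k) : Matrix (Fin N₀) (Fin N₀) k)) ≤
        W := by
      rw [hWdef, Submodule.map_span, Submodule.span_le]
      rintro _ ⟨_, ⟨g', rfl⟩, rfl⟩
      refine Submodule.subset_span ⟨g * g', ?_⟩
      simp [map_mul, Matrix.mulVec_mulVec]
    intro w hw
    exact hle (Submodule.mem_map_of_mem hw)
  set d : ℕ := Module.finrank k ↥W with hddef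
  set ρ₁ : ↥G →* GL (Fin d) k := (subRep W).comp (ρ₀G.codRestrict (stabSubmodule W) hstabW)
    with hρ₁def
  have hρ₁ : MonoidHom.IsAlgebraicGL ρ₁ := hρ₀G.comp_codRestrict hstabW (isAlgebraicGL_subRep W)
  let e : ↥W ≃ₗ[k] (Fin d → k) := (basisSub W).equivFun
  set v₁ : Fin d → k := e ⟨v₀, hv₀W⟩ with hv₁def
  have hρ₁e : ∀ (g : ↥G) (w : ↥W), ((ρ₁ g : GL (Fin d) k) : Matrix (Fin d) (Fin d) k) *ᵥ e w =
      e ⟨((ρ₀G g : GL (Fin N₀) k) : Matrix (Fin N₀) (Fin N₀) k) *ᵥ (w : Fin N₀ → k),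
        (mem_stabSubmodule_iff.1 (hstabW g)) _ w.2⟩ := by
    intro g w
    have h1 : ((ρ₁ g : GL (Fin d) k) : Matrix (Fin d) (Fin d) k) =
        LinearMap.toMatrix (basisSub W) (basisSub W) (subLin W (ρ₀G.codRestrict _ hstabW g)) := rfl
    rw [h1, Module.Basis.equivFun_apply, LinearMap.toMatrix_mulVec_repr,
      Module.Basis.equivFun_apply]
    congr 2
  have horb₁ : ∀ g : ↥G, orbVec ρ₁ v₁ g =
      e ⟨((ρ₀G g : GL (Fin N₀) k) : Matrix (Fin N₀) (Fin N₀) k) *ᵥ v₀, hmemW g⟩ := by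
    intro g
    rw [orbVec_def, hv₁def, hρ₁e]
  have hstab₁ : ∀ g : ↥G, (∃ c : k, ((ρ₁ g : GL (Fin d) k) : Matrix (Fin d) (Fin d) k) *ᵥ v₁ =
      c • v₁) ↔ (g : GL n k) ∈ B₀ := by
    intro g
    rw [← hstab₀ (g : GL n k)]
    constructor
    · rintro ⟨c, hc⟩
      refine ⟨c, ?_⟩
      rw [← orbVec_def, horb₁, hv₁def, ← map_smul] at hc
      have h2 := e.injective hc
      exact congrArg Subtype.val h2
    · rintro ⟨c, hc⟩
      refine ⟨c, ?_⟩
      rw [← orbVec_def, horb₁, hv₁def, ← map_smul]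
      congr 1
      exact Subtype.ext hc
  have hspan₁ : Submodule.span k (Set.range fun g : ↥G =>
      ((ρ₁ g : GL (Fin d) k) : Matrix (Fin d) (Fin d) k) *ᵥ v₁) = ⊤ := by
    apply top_le_iff.1
    have htop : (⊤ : Submodule k ↥W).map e.toLinearMap = ⊤ := by
      rw [Submodule.map_top, LinearMap.range_eq_top]
      exact e.surjective
    rw [← htop, ← Submodule.span_setOf_mem_eq_top (s := Set.range fun g : ↥G =>
      ((ρ₀G g : GL (Fin N₀) k) : Matrix (Fin N₀) (Fin N₀) k) *ᵥ v₀), Submodule.map_span,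
      Submodule.span_le]
    rintro _ ⟨w, ⟨g, hg⟩, rfl⟩
    refine Submodule.subset_span ⟨g, ?_⟩
    change orbVec ρ₁ v₁ g = e w
    rw [horb₁]
    congr 1
    exact Subtype.ext hg
  -- Step 2: diagonalise `ρ₁(T)`
  set Tρ : Subgroup (GL (Fin d) k) := (T.subgroupOf G).map ρ₁ with hTρ
  have hmemTρ : ∀ {x : GL (Fin d) k}, x ∈ Tρ ↔ ∃ g : ↥G, (g : GL n k) ∈ T ∧ ρ₁ g = x := by
    intro x
    simp only [hTρ, Subgroup.mem_map, Subgroup.mem_subgroupOf]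
  have hcommρ : IsMulCommutative ↥Tρ := by
    refine ⟨⟨fun a b => Subtype.ext ?_⟩⟩
    obtain ⟨g, hg, hga⟩ := hmemTρ.1 a.2
    obtain ⟨g', hg', hgb⟩ := hmemTρ.1 b.2
    rw [Subgroup.coe_mul, Subgroup.coe_mul, ← hga, ← hgb, ← map_mul, ← map_mul]
    congr 1
    exact Subtype.ext (by
      have := congrArg Subtype.val
        (hTt.2.1.is_comm.comm (⟨(g : GL n k), hg⟩ : ↥T) ⟨(g' : GL n k), hg'⟩)
      simpa using this)
  have hssρ : ∀ x ∈ Tρ, IsSemisimpleElt x := by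
    intro x hx
    obtain ⟨g, hg, rfl⟩ := hmemTρ.1 hx
    exact IsSemisimpleElt.map_of_isAlgebraicGL hρ₁ g.2 (hTt.2.2 _ hg)
  obtain ⟨Pm, hPm⟩ := exists_conj_le_diagonalSubgroup hcommρ hssρ
  set ρ₂ : ↥G →* GL (Fin d) k := (MulAut.conj Pm).toMonoidHom.comp ρ₁ with hρ₂def
  set v₂ : Fin d → k := ((Pm : GL (Fin d) k) : Matrix (Fin d) (Fin d) k) *ᵥ v₁ with hv₂def
  have hρ₂ : MonoidHom.IsAlgebraicGL ρ₂ := hρ₁.conj_comp Pm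
  have hρ₂apply : ∀ g : ↥G, ((ρ₂ g : GL (Fin d) k) : Matrix (Fin d) (Fin d) k) =
      (Pm : Matrix (Fin d) (Fin d) k) * (ρ₁ g : Matrix (Fin d) (Fin d) k) *
        ((Pm⁻¹ : GL (Fin d) k) : Matrix (Fin d) (Fin d) k) := by
    intro g
    simp [hρ₂def, MulAut.conj_apply]
  have hPP : ((Pm⁻¹ : GL (Fin d) k) : Matrix (Fin d) (Fin d) k) * (Pm : Matrix (Fin d) (Fin d) k) =
      1 := by
    rw [← Units.val_mul, inv_mul_cancel, Units.val_one]
  have horb₂ : ∀ g : ↥G, orbVec ρ₂ v₂ g =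
      ((Pm : GL (Fin d) k) : Matrix (Fin d) (Fin d) k) *ᵥ orbVec ρ₁ v₁ g := by
    intro g
    rw [orbVec_def, hρ₂apply, hv₂def, Matrix.mulVec_mulVec, mul_assoc, hPP, mul_one,
      ← Matrix.mulVec_mulVec, orbVec_def]
  have hstab₂ : ∀ g : ↥G, (∃ c : k, ((ρ₂ g : GL (Fin d) k) : Matrix (Fin d) (Fin d) k) *ᵥ v₂ =
      c • v₂) ↔ (g : GL n k) ∈ B₀ := by
    intro g
    rw [← hstab₁ g, ← orbVec_def, horb₂, hv₂def]
    constructor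
    · rintro ⟨c, hc⟩
      refine ⟨c, ?_⟩
      have := congrArg (fun w => ((Pm⁻¹ : GL (Fin d) k) : Matrix (Fin d) (Fin d) k) *ᵥ w) hc
      rwa [Matrix.mulVec_mulVec, hPP, Matrix.one_mulVec, Matrix.mulVec_smul, Matrix.mulVec_mulVec,
        hPP, Matrix.one_mulVec] at this
    · rintro ⟨c, hc⟩
      exact ⟨c, by rw [orbVec_def, hc, Matrix.mulVec_smul]⟩
  have hv₁0 : v₁ ≠ 0 := by
    intro h0
    apply hv₀
    have : (⟨v₀, hv₀W⟩ : ↥W) = 0 := e.injective (by rw [← hv₁def, h0, map_zero])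
    exact congrArg Subtype.val this
  have hv₂0 : v₂ ≠ 0 := by
    intro h0
    apply hv₁0
    have := congrArg (fun w => ((Pm⁻¹ : GL (Fin d) k) : Matrix (Fin d) (Fin d) k) *ᵥ w) h0
    simpa [hv₂def, Matrix.mulVec_mulVec, ← Units.val_mul] using this
  have hspan₂ : Submodule.span k (Set.range fun g : ↥G =>
      ((ρ₂ g : GL (Fin d) k) : Matrix (Fin d) (Fin d) k) *ᵥ v₂) = ⊤ := by
    apply top_le_iff.1
    intro w _
    have hw : ((Pm⁻¹ : GL (Fin d) k) : Matrix (Fin d) (Fin d) k) *ᵥ w ∈ Submodule.span k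
        (Set.range fun g : ↥G => ((ρ₁ g : GL (Fin d) k) : Matrix (Fin d) (Fin d) k) *ᵥ v₁) := by
      rw [hspan₁]; trivial
    have hle : (Submodule.span k (Set.range fun g : ↥G =>
        ((ρ₁ g : GL (Fin d) k) : Matrix (Fin d) (Fin d) k) *ᵥ v₁)).map
        (Matrix.mulVecLin ((Pm : GL (Fin d) k) : Matrix (Fin d) (Fin d) k)) ≤
        Submodule.span k (Set.range fun g : ↥G =>
          ((ρ₂ g : GL (Fin d) k) : Matrix (Fin d) (Fin d) k) *ᵥ v₂) := by
      rw [Submodule.map_span, Submodule.span_le]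
      rintro _ ⟨_, ⟨g, rfl⟩, rfl⟩
      refine Submodule.subset_span ⟨g, ?_⟩
      change orbVec ρ₂ v₂ g = ((Pm : GL (Fin d) k) : Matrix (Fin d) (Fin d) k) *ᵥ orbVec ρ₁ v₁ g
      exact horb₂ g
    have h1 := hle (Submodule.mem_map_of_mem (f := Matrix.mulVecLin ((Pm : GL (Fin d) k) :
      Matrix (Fin d) (Fin d) k)) hw)
    simpa [Matrix.mulVec_mulVec, ← Units.val_mul] using h1
  have hdiag₂ : ∀ t : ↥T, ∃ dv : Fin d → k,
      ((ρ₂ ⟨t, hT.1 t.2⟩ : GL (Fin d) k) : Matrix (Fin d) (Fin d) k) = Matrix.diagonal dv := by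
    intro t
    have hmem : ρ₂ ⟨t, hT.1 t.2⟩ ∈ Tρ.map (MulAut.conj Pm).toMonoidHom :=
      Subgroup.mem_map_of_mem _ (hmemTρ.2 ⟨⟨t, hT.1 t.2⟩, t.2, rfl⟩)
    obtain ⟨dv, hd⟩ := hPm hmem
    exact ⟨fun i => (dv i : k), by rw [← hd, coe_diagonalGL]⟩
  have h₂ : ChevalleyData G T B₀ ρ₂ v₂ :=
    { conn := hG
      maxTorus := hT
      borel := hB₀
      torus_le := hTB₀
      algebraic := hρ₂
      diag := hdiag₂
      ne_zero := hv₂0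
      stab_iff := hstab₂
      closed := isClosed_orbitCone_of_borel_le_lineStabilizer_holds hG hB₀ ρ₂ hρ₂ v₂
        fun b hb => (hstab₂ b).2 hb
      span := hspan₂ }
  -- Step 3: separating cocharacter, lowest weight `μ`, the lowest weight line
  obtain ⟨γ, hγ⟩ := exists_cochar_separating hTt h₂.wtL
  have hsep : ∀ i j, h₂.wtInt γ i = h₂.wtInt γ j → h₂.wt i = h₂.wt j := fun i j hij =>
    congrArg (fun χ : ↥(characterLattice T) => (χ : ↥T →* kˣ)) (hγ i j hij)
  obtain ⟨i₀, hi₀⟩ := Function.ne_iff.1 hv₂0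
  have hne : (Finset.univ : Finset (Fin d)).Nonempty := ⟨i₀, Finset.mem_univ _⟩
  set μ : ℤ := Finset.univ.inf' hne (h₂.wtInt γ) with hμdef
  have hμ : ∀ i, μ ≤ h₂.wtInt γ i := fun i => Finset.inf'_le _ (Finset.mem_univ i)
  obtain ⟨i₁, -, hμi₁⟩ := Finset.exists_mem_eq_inf' hne (h₂.wtInt γ)
  have hmi₁ : h₂.wtInt γ i₁ = μ := by rw [hμdef, hμi₁]
  obtain ⟨r₀, hr₀G, hr₀N, hline⟩ := h₂.exists_lowest_line γ hsep hμ ⟨i₁, hmi₁⟩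
  set R₀ : ↥G := ⟨r₀, hr₀G⟩ with hR₀def
  set u₀ : Fin d → k := orbVec ρ₂ v₂ R₀ with hu₀def
  -- the linear lowest weight projection
  let πL : (Fin d → k) →ₗ[k] (Fin d → k) :=
    LinearMap.pi fun i => if h₂.wtInt γ i = μ then LinearMap.proj i else 0
  have hπL : ∀ (w : Fin d → k) (i : Fin d), πL w i = if h₂.wtInt γ i = μ then w i else 0 := by
    intro w i
    by_cases hi : h₂.wtInt γ i = μ <;> simp [πL, hi]
  have hπL_all : ∀ w : Fin d → k, πL w ∈ (k ∙ u₀ : Submodule k (Fin d → k)) := by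
    have hle : Submodule.span k (Set.range fun g : ↥G =>
        ((ρ₂ g : GL (Fin d) k) : Matrix (Fin d) (Fin d) k) *ᵥ v₂) ≤ (k ∙ u₀).comap πL := by
      rw [Submodule.span_le]
      rintro _ ⟨g, rfl⟩
      rw [SetLike.mem_coe, Submodule.mem_comap]
      have h1 := hline g
      convert h1 using 1
      funext i
      rw [hπL, orbVec_def]
    intro w
    have hw : w ∈ (k ∙ u₀).comap πL := by rw [h₂.span] at hle; exact hle Submodule.mem_top
    exact hw
  -- Step 4: `i₁` is the only lowest weight coordinate
  have huniq : ∀ i, h₂.wtInt γ i = μ → i = i₁ := by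
    intro i hi
    have he : ∀ j, h₂.wtInt γ j = μ →
        (Pi.single j 1 : Fin d → k) ∈ (k ∙ u₀ : Submodule k (Fin d → k)) := by
      intro j hj
      have h1 := hπL_all (Pi.single j 1)
      have h2 : πL (Pi.single j 1) = Pi.single j 1 := by
        funext l
        rw [hπL]
        by_cases hl : h₂.wtInt γ l = μ
        · rw [if_pos hl]
        · rw [if_neg hl, Pi.single_apply, if_neg]
          rintro rfl
          exact hl hj
      rwa [h2] at h1
    obtain ⟨a, ha⟩ := Submodule.mem_span_singleton.1 (he i hi)
    obtain ⟨a', ha'⟩ := Submodule.mem_span_singleton.1 (he i₁ hmi₁)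
    have ha0 : a' ≠ 0 := by
      rintro rfl
      rw [zero_smul] at ha'
      have h1 := congrFun ha' i₁
      rw [Pi.zero_apply, Pi.single_eq_same] at h1
      exact one_ne_zero h1.symm
    have hu₀ : u₀ = a'⁻¹ • (Pi.single i₁ 1 : Fin d → k) := by
      rw [← ha', smul_smul, inv_mul_cancel₀ ha0, one_smul]
    rw [hu₀, smul_smul] at ha
    have h3 := congrFun ha i
    simp only [Pi.smul_apply, Pi.single_eq_same, smul_eq_mul, Pi.single_apply] at h3
    by_contra hne
    rw [if_neg hne, mul_zero] at h3
    exact one_ne_zero h3.symm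
  -- Step 5: `u₀ = u₀ i₁ • e_{i₁}` with `u₀ i₁ ≠ 0`
  obtain ⟨g₁, hg₁⟩ := h₂.exists_orbVec_apply_ne_zero i₁
  have hu₀eq : u₀ = u₀ i₁ • (Pi.single i₁ 1 : Fin d → k) ∧ u₀ i₁ ≠ 0 := by
    obtain ⟨c₁, hc₁⟩ := Submodule.mem_span_singleton.1 (hπL_all (orbVec ρ₂ v₂ g₁))
    have hc₁0 : c₁ ≠ 0 := by
      rintro rfl
      have := congrFun hc₁ i₁
      rw [zero_smul, hπL, if_pos hmi₁] at this
      exact hg₁ this.symm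
    have hu : u₀ = c₁⁻¹ • πL (orbVec ρ₂ v₂ g₁) := by
      rw [← hc₁, smul_smul, inv_mul_cancel₀ hc₁0, one_smul]
    have hsupp : ∀ j, j ≠ i₁ → u₀ j = 0 := by
      intro j hj
      rw [hu, Pi.smul_apply, hπL, if_neg (fun hj' => hj (huniq j hj')), smul_zero]
    refine ⟨funext fun j => ?_, fun h0 => ?_⟩
    · by_cases hj : j = i₁
      · subst hj; simp
      · rw [Pi.smul_apply, Pi.single_apply, if_neg hj, smul_zero, hsupp j hj]
    · have hz : u₀ = 0 := funext fun j => by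
        by_cases hj : j = i₁
        · subst hj; exact h0
        · exact hsupp j hj
      exact h₂.orbVec_ne_zero R₀ hz
  obtain ⟨hu₀eq, hu₀0⟩ := hu₀eq
  -- Step 6: the final data `(r₀ B₀ r₀⁻¹, e_{i₁})`
  set a : k := (u₀ i₁)⁻¹ with hadef
  have ha : a ≠ 0 := inv_ne_zero hu₀0
  set v : Fin d → k := Pi.single i₁ 1 with hvdef
  have hva : v = a • orbVec ρ₂ v₂ R₀ := by
    rw [← hu₀def, hu₀eq, smul_smul, hadef, inv_mul_cancel₀ hu₀0, one_smul]
  have hvorb : ∀ g : ↥G, orbVec ρ₂ v g = a • orbVec ρ₂ v₂ (g * R₀) := by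
    intro g
    rw [orbVec_def, hva, Matrix.mulVec_smul, ← orbVec_mul]
  refine ⟨B₀.map (MulAut.conj r₀ : GL n k →* GL n k), d, ρ₂, v, γ, i₁, ?_, ?_⟩
  · refine
      { conn := hG
        maxTorus := hT
        borel := hB₀.map_conj hr₀G
        torus_le := ?_
        algebraic := hρ₂
        diag := hdiag₂
        ne_zero := ?_
        stab_iff := ?_
        closed := ?_
        span := ?_ }
    · rw [← Subgroup.mem_normalizer_iff_map_conj_eq.1 hr₀N]
      exact Subgroup.map_mono hTB₀
    · intro h0
      have := congrFun h0 i₁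
      simp [hvdef] at this
    · intro g
      rw [mem_map_conj_iff,
        ← hstab₂ ⟨r₀⁻¹ * g * r₀, G.mul_mem (G.mul_mem (G.inv_mem hr₀G) g.2) hr₀G⟩,
        ← orbVec_def, ← orbVec_def, hvorb,
        show (⟨r₀⁻¹ * (g : GL n k) * r₀, _⟩ : ↥G) = R₀⁻¹ * g * R₀ from rfl, mul_assoc,
        orbVec_mul ρ₂ v₂ R₀⁻¹ (g * R₀)]
      constructor
      · rintro ⟨c, hc⟩
        refine ⟨c, ?_⟩
        rw [hva, smul_comm] at hc
        have hc' := smul_right_injective _ ha hc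
        rw [hc', Matrix.mulVec_smul, ← orbVec_mul, inv_mul_cancel, orbVec_one]
      · rintro ⟨c, hc⟩
        refine ⟨c, ?_⟩
        have h2 := congrArg (fun w => ((ρ₂ R₀ : GL (Fin d) k) : Matrix (Fin d) (Fin d) k) *ᵥ w) hc
        simp only [Matrix.mulVec_mulVec, ← Units.val_mul, ← map_mul, mul_inv_cancel, map_one,
          Units.val_one, Matrix.one_mulVec, Matrix.mulVec_smul] at h2
        rw [h2, hva, ← orbVec_def, smul_comm]
    · rw [orbitCone_eq_of_eq_smul_orbVec ρ₂ ha R₀ hva]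
      exact h₂.closed
    · apply top_le_iff.1
      rw [← hspan₂, Submodule.span_le]
      rintro _ ⟨g, rfl⟩
      have h1 : ((ρ₂ g : GL (Fin d) k) : Matrix (Fin d) (Fin d) k) *ᵥ v₂ =
          a⁻¹ • orbVec ρ₂ v (g * R₀⁻¹) := by
        rw [hvorb, mul_assoc, inv_mul_cancel, mul_one, smul_smul, inv_mul_cancel₀ ha, one_smul,
          orbVec_def]
      change ((ρ₂ g : GL (Fin d) k) : Matrix (Fin d) (Fin d) k) *ᵥ v₂ ∈ _
      rw [h1]
      exact Submodule.smul_mem _ _ (Submodule.subset_span ⟨g * R₀⁻¹, rfl⟩)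
  · exact
      { sep := hsep
        low := fun i => hmi₁.symm ▸ hμ i
        uniq := fun i hi => huniq i (hi.trans hmi₁)
        v_eq := rfl }

end Existence

end Literature.NumberTheory.Automorphic
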